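/-
Copyright (c) 2026 the pub-hodgecm-mathlib formalisation cell (harness21).  Prover seat hodgecm-mathlib-LH7-p06 (g3), req620 Track A «(D-RAM) FOUR-FRAME» squad
((β₂) road (R-36), the K6 road; β₂ sub-dealer LH4-p04 (g10) WORD #38 «LH7-p06: ‹K6-(f) UNIFORM DENSITY›» — the density letter `n_t i = k·#S_t i` of ★ p864238 §3 reduced to the
per-digit fibre letter ‹K6-(f′) UNIFORM FIBRE›, in LH4-p19 (g2)'s count-socket ∕ LH4-p18 (g4)'s K6-0 currency), 2026-09-05.
-/
import Summits.HodgeConjecture.HodgeConjecture.Theorems.F0P3cDyRamConeCellCountSocketThree   -- ★ p863833 (LH4-p19 (g2)): the three-way count socket frame; brings ★ `…FaceTubeAbove` weight head, ★ p862250, ★ DEFS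
import HarnessLib

/-!
# Crux `H413`, line LH4 «(D-RAM) FOUR-FRAME» — (β₂) road, K6-(f): «UNIFORM DENSITY FROM A UNIFORM FIBRE» — the weighted size of a cone cell is `(2·q^b·φ) · #(Rd.filter LIT)` as soon
# as every literal digit carries a populated fibre of ONE size `φ`

Cell `hodgecm-mathlib` (D-0151), FLOOR 0, crux item H413 = `stmt-HodgeConjecture-24833`, route of record `HCCMUnconditional`; squad F0∕P3c∕LH4 (hand LH7-p06); lane
`--supports stmt-HodgeConjecture-24833 --as helper` (count-neutral; pays NO tier-0 row).  THEOREMS ONLY (no `def`, no instance, no notation, no `sorry`, default heartbeats);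
★-only imports; states NO law; (β₂), ‹K6-(f′)› stay HYPOTHESES.  FRAME = ★ `…ConeCellCountSocketThree.cellDiff_eq_zero_of_fibration_reads₃`'s VERBATIM (E-side wild datum, line model,
weight letter `hf`, `u : E`, `1 ≤ b`, `d ≤ b`, `IsOrd(lam)`) + `hjiso` + `hcell` + `hfin` + the fibration letters `CLS Vf ε r Rd hRd2 hRd3 LIT hI hV hLit` + (hP) populatedness — i.e. LH4-p18
(g4)'s K6-0 `…ConeCellPerCellLaw` HEAD′ frame minus the label letters (`NX`, `ψ`, `hF`, `P₁`, `Q₁`, reads) — plus ONE new letter `hφ` (the per-digit fibre count).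
WHY (β₂ WORD #37∕#38; SIG-K6f.v1 `F0/P3c/LH7/LH7-p06/g3/SIG-K6f.v1.LH7p06g3.md` §1).  ★ p864238 §3 `sum_window_eq_sum_window_of_perCellLaw` (K6-(e)-0) carries the density letter
‹K6-(f)› `n_t i = k · #S_t i` with ONE `k` for the row and both literals, `n_t i = Σᶠ_{levelSetDep} f` the weighted size, `S_t i = Rd.filter LIT` the cell's literal digits.  THIS FILE
reduces it, cell by cell, to the GEOMETRIC letter ‹K6-(f′) UNIFORM FIBRE› «the populated fibre `{Λ ∣ ∃ x₀, GEN ∧ (CLS ↔ ε) ∧ |Vf x₀ − jE y| ≤ r}` over a literal digit `y` has ncard `φ`»: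
then `n(cell) = (2·q^b·φ)·#(Rd.filter LIT)` (`q = #𝓀[E]`) — so `k = 2·q^b·φ`, and (f) holds across the window and both frames exactly when ONE `φ` serves every literal digit of the row
(ONE chart `(κ₀, ξ₀)`, ONE digit system `Rd`; SIG-K6f §2).  Mechanism: ★ `…FaceTubeAbove.finsum_levelSetDep_inter_weight_eq_two_mul_pow_mul_ncard_of_le` (two-valued weight,
`d ≤ b`) makes `n(cell) = 2q^b·#{Λ ∈ cell ∣ f ≠ 0}`; (hP) + `hcell` make that set the populated class `S`; the digit map `π : S → Rd.filter LIT` (★ p863833 §1's construction from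
`hV`, `hRd2`, `hLit`, uniqueness from `hI` + `hRd3`) has fibres = the `∃`-fibres, each of ncard `φ`, so `#S = φ·#(Rd.filter LIT)` (`Finset.card_eq_sum_card_fiberwise`).
* §1 `ncard_eq_mul_card_of_digit_fibre` — abstract (socket-agnostic): `#S = φ · #(Rd.filter LIT)`.
* §2 HEAD `cellCount_eq_mul_card_of_digit_fibre` — socket shape: `((Σᶠ_{levelSetDep(j,b; lam − jE u)} f b j : ℕ) : ℤ) = (2·q^b·φ) · #(Rd.filter LIT)` = ★ p864238's `hk_t i` at `k := 2·q^b·φ`.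
WHAT IS NOT CLAIMED: ‹K6-(f′)› itself (the cross-cell ∕ cross-literal constancy of `φ` — SIG-K6f §4: not reachable by the tree's transports; a direct orbit count or the d = 2 table road),
the label bookkeeping (K6-0), any census law.
HONEST LABEL.  Count-neutral bookkeeping; every mathematical input is a HYPOTHESIS; nothing printed is asserted; no census law is stated; `HC_CM` is proved only modulo the 7 printed
citations (2 remaining named inputs: hLiu418 = `stmt-HodgeConjecture-24832`, h413 = `stmt-HodgeConjecture-24833`) until rung 0 closes.
## References
* [Kottwitz1986BaseChangeUnits] R. E. Kottwitz, *Base change for unit elements of Hecke algebras*, Compositio Math. 60 (1986): §1 pp. 240–241 (fixed-lattice counts, cell by cell).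
* [LabesseLanglands1979] J.-P. Labesse, R. P. Langlands, *L-indistinguishability for SL(2)*, Canad. J. Math. 31 (1979): §2 (2.2) p. 9 (κ-signed counts).
* [Rogawski1990] J. D. Rogawski, *Automorphic Representations of Unitary Groups in Three Variables*, Ann. of Math. Stud. 123 (1990): §4.9 Prop. 4.9.1 (b) p. 55.
* [Jacobowitz1962] R. Jacobowitz, *Hermitian forms over local fields*, Amer. J. Math. 84 (1962): §4.
-/

set_option autoImplicit false

noncomputable section

namespace Summit.HodgeConjecture.HodgeConjecture.Cruxes.H413.F0P3cDyRamUniformDensityOfUniformFibre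

open scoped Valued WithZero Matrix MatrixGroups Classical
open WithZero Finset
open Literature.NumberTheory.Automorphic Literature.NumberTheory.Automorphic.HermitianLattice Literature.NumberTheory.Automorphic.UnitaryLatticeTree
open Literature.NumberTheory.Automorphic.UnitaryThreeFourFrame (IsRamifiedQuadraticDatum)
open Summit.HodgeConjecture.HodgeConjecture.Cruxes.H413.F0P3cDyRamToricCensusDefs
open Summit.HodgeConjecture.HodgeConjecture.Cruxes.H413.F0P3cDyRamConeCellFaceTubeAbove (finsum_levelSetDep_inter_weight_eq_two_mul_pow_mul_ncard_of_le)

variable {E M : Type} [Field E] [Valued E ℤᵐ⁰] [Field M] [Valued M ℤᵐ⁰] {σ : E →+* E} {ρ Θ : M →+* M} {α : M}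

/-! ## §1 The abstract count: a populated class with fibres of one size over the literal digits -/

/-- **`#S = φ · #(Rd.filter LIT)` FOR A UNIFORM FIBRE (abstract, socket-agnostic).**  Letters of ★ p863833 §1 (generator data `GEN`, class `CLS`, coordinate `Vf`, `jE` isometric,
digit system `Rd` modulo `r` — covering `hRd2`, separated `hRd3` —, literal `LIT`, (hI) generator independence, (hP) preimages, (hL) literal digits, finiteness) and the per-digit fibre
letter ‹K6-(f′)› `hφ` («the populated fibre over every literal digit has ncard `φ`») ⟹ the populated class `S = {Λ ∣ ∃ x₀, GEN Λ x₀ ∧ (CLS x₀ ↔ ε)}` has `#S = φ · #(Rd.filter LIT)`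
(digit map `π : S → Rd.filter LIT`, fibres = the `∃`-fibres; `Finset.card_eq_sum_card_fiberwise`). [cite: Kottwitz1986BaseChangeUnits, §1 pp. 240–241] [cite: LabesseLanglands1979, §2 (2.2) p. 9] -/
theorem ncard_eq_mul_card_of_digit_fibre {X : Type} (GEN : X → M → Prop) (CLS : M → Prop) (Vf : M → M) (ε : Prop)
    (jE : E →+* M) (hjiso : ∀ a, Valued.v (jE a) = Valued.v a) (r : ℤᵐ⁰)
    (Rd : Finset E) (hRd2 : ∀ V : E, σ V = V → Valued.v V ≤ 1 → ∃ V₀ ∈ Rd, Valued.v (V - V₀) ≤ r)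
    (hRd3 : ∀ V ∈ Rd, ∀ V' ∈ Rd, Valued.v (V - V') ≤ r → V = V')
    (LIT : E → Prop) [DecidablePred LIT]
    (hI : ∀ (Λ : X) (x₀ x₀' : M), GEN Λ x₀ → GEN Λ x₀' → (CLS x₀ ↔ CLS x₀') ∧ Valued.v (Vf x₀' - Vf x₀) ≤ r)
    (hP : ∀ (Λ : X) (x₀ : M), GEN Λ x₀ → ∃ Ve : E, jE Ve = Vf x₀ ∧ σ Ve = Ve ∧ Valued.v Ve ≤ 1)
    (hL : ∀ (Λ : X) (x₀ : M) (V₀ : E), GEN Λ x₀ → V₀ ∈ Rd → Valued.v (Vf x₀ - jE V₀) ≤ r → LIT V₀)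
    (φ : ℕ) (hφ : ∀ y ∈ Rd.filter LIT, {Λ : X | ∃ x₀, GEN Λ x₀ ∧ (CLS x₀ ↔ ε) ∧ Valued.v (Vf x₀ - jE y) ≤ r}.ncard = φ)
    (hfin : {Λ : X | ∃ x₀, GEN Λ x₀}.Finite) :
    {Λ : X | ∃ x₀, GEN Λ x₀ ∧ (CLS x₀ ↔ ε)}.ncard = φ * (Rd.filter LIT).card := by
  -- (adapted from ★ p863833 §1: the digit map `π` and the populated class `S`)
  set B : Finset E := Rd.filter LIT with hB
  have hdig : ∀ Λ : X, (∃ x₀, GEN Λ x₀) → ∃ V₀ ∈ B, ∃ x₀, GEN Λ x₀ ∧ Valued.v (Vf x₀ - jE V₀) ≤ r := by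
    rintro Λ ⟨x₀, hG⟩
    obtain ⟨Ve, hjVe, hσVe, hVe1⟩ := hP Λ x₀ hG
    obtain ⟨V₀, hV₀R, hnear⟩ := hRd2 Ve hσVe hVe1
    have hnearM : Valued.v (Vf x₀ - jE V₀) ≤ r := by rw [← hjVe, ← map_sub, hjiso]; exact hnear
    exact ⟨V₀, mem_filter.2 ⟨hV₀R, hL Λ x₀ V₀ hG hV₀R hnearM⟩, x₀, hG, hnearM⟩
  choose! π hπB hπnear using hdig
  have hπuniq : ∀ (Λ : X) (x₀ : M) (V₀ : E), GEN Λ x₀ → V₀ ∈ Rd → (Valued.v (Vf x₀ - jE V₀) ≤ r ↔ π Λ = V₀) := by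
    intro Λ x₀ V₀ hG hV₀R
    obtain ⟨x₁, hG₁, h₁⟩ := hπnear Λ ⟨x₀, hG⟩
    have hI₁ : Valued.v (Vf x₁ - Vf x₀) ≤ r := (hI Λ x₀ x₁ hG hG₁).2
    have hπR : π Λ ∈ Rd := (mem_filter.1 (hπB Λ ⟨x₀, hG⟩)).1
    constructor
    · intro h0
      refine hRd3 _ hπR _ hV₀R ?_
      rw [← hjiso, map_sub]
      have e : jE (π Λ) - jE V₀ = (Vf x₀ - jE V₀) - (Vf x₁ - jE (π Λ)) + (Vf x₁ - Vf x₀) := by ring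
      rw [e]
      exact (Valuation.map_add _ _ _).trans (max_le ((Valuation.map_sub _ _ _).trans (max_le h0 h₁)) hI₁)
    · rintro rfl
      have e : Vf x₀ - jE (π Λ) = (Vf x₁ - jE (π Λ)) - (Vf x₁ - Vf x₀) := by ring
      rw [e]
      exact (Valuation.map_sub _ _ _).trans (max_le h₁ hI₁)
  set S : Finset X := hfin.toFinset.filter (fun Λ => ∃ x₀, GEN Λ x₀ ∧ (CLS x₀ ↔ ε)) with hS
  have hmemS : ∀ Λ, Λ ∈ S ↔ ∃ x₀, GEN Λ x₀ ∧ (CLS x₀ ↔ ε) := by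
    intro Λ
    rw [hS, mem_filter, Set.Finite.mem_toFinset, Set.mem_setOf_eq]
    exact ⟨fun hh => hh.2, fun hh => ⟨(by obtain ⟨x₀, hG, -⟩ := hh; exact ⟨x₀, hG⟩), hh⟩⟩
  have hSset : (S : Set X) = {Λ : X | ∃ x₀, GEN Λ x₀ ∧ (CLS x₀ ↔ ε)} := by ext Λ; rw [mem_coe, hmemS, Set.mem_setOf_eq]
  have hSB : ∀ Λ ∈ S, π Λ ∈ B := fun Λ hΛ => by
    obtain ⟨x₀, hG, -⟩ := (hmemS Λ).1 hΛ
    exact hπB Λ ⟨x₀, hG⟩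
  have hcardfib : ∀ y ∈ B, (S.filter fun Λ => π Λ = y).card = φ := by
    intro y hy
    have hyR : y ∈ Rd := (mem_filter.1 hy).1
    have hset : ((S.filter fun Λ => π Λ = y) : Set X) = {Λ : X | ∃ x₀, GEN Λ x₀ ∧ (CLS x₀ ↔ ε) ∧ Valued.v (Vf x₀ - jE y) ≤ r} := by
      ext Λ
      simp only [coe_filter, Set.mem_setOf_eq, hmemS]
      constructor
      · rintro ⟨⟨x₀, hG, hC⟩, hπ⟩
        exact ⟨x₀, hG, hC, (hπuniq Λ x₀ y hG hyR).2 hπ⟩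
      · rintro ⟨x₀, hG, hC, hn⟩
        exact ⟨⟨x₀, hG, hC⟩, (hπuniq Λ x₀ y hG hyR).1 hn⟩
    rw [← Set.ncard_coe_finset, hset, hφ y hy]
  rw [← hSset, Set.ncard_coe_finset, card_eq_sum_card_fiberwise (fun Λ hΛ => hSB Λ hΛ), sum_congr rfl hcardfib, sum_const, smul_eq_mul, mul_comm]

/-! ## §2 HEAD — the weighted size of a cone cell under a uniform fibre -/

/-- **HEAD — «UNIFORM DENSITY FROM A UNIFORM FIBRE», socket shape.**  Frame of ★ `…ConeCellCountSocketThree.cellDiff_eq_zero_of_fibration_reads₃` VERBATIM up to the fibration letters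
(`hI hV hLit` in the consumer's currency, (hP) populatedness) — no `NX ψ hF hbase P₁ Q₁` reads — plus the ONE letter ‹K6-(f′)› `hφ : ∀ y ∈ Rd.filter LIT, #fibre(y) = φ`.  THEN
`((Σᶠ_{Λ ∈ levelSetDep(j, b; lam − jE u)} f b j Λ : ℕ) : ℤ) = (2·q^b·φ) · #(Rd.filter LIT)`, `q = #𝓀[E]` — the `hk_t i` letter of ★ p864238 §3 at `k := 2·q^b·φ`.
[cite: Kottwitz1986BaseChangeUnits, §1 pp. 240–241] [cite: LabesseLanglands1979, §2 (2.2) p. 9] [cite: Rogawski1990, §4.9 Prop. 4.9.1 (b) p. 55] -/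
theorem cellCount_eq_mul_card_of_digit_fibre [CompleteSpace E] [IsDiscreteValuationRing 𝒪[E]] [Finite 𝓀[E]]
    (σ : E →+* E) (hσ : ∀ a, σ (σ a) = a) (hvσ : ∀ a, Valued.v (σ a) = Valued.v a)
    {ϖ : E} (hϖ : Valued.v ϖ = WithZero.exp (-1 : ℤ)) {d t : ℕ} (hD : IsRamifiedQuadraticDatum σ ϖ d t) (h2v : Valued.v (2 : E) < 1)
    {H₂ : Matrix (Fin 2) (Fin 2) E} (hH₂σ : (H₂.map σ)ᵀ = H₂) {hW : E} (hhW : Valued.v hW = 1) (hhWσ : σ hW = hW) (jE : E →+* M)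
    (hρρ : ∀ x, ρ (ρ x) = x) (hvρ : ∀ x, Valued.v (ρ x) = Valued.v x) (hα : ρ α ≠ α) (hα1 : Valued.v α ≤ 1)
    (hint : ∀ z : M, Valued.v z ≤ 1 → Valued.v ((z - ρ z) / (α - ρ α)) ≤ 1)
    (hΘΘ : ∀ x, Θ (Θ x) = x) (hΘρ : ∀ x, Θ (ρ x) = ρ (Θ x)) (hvΘ : ∀ x, Valued.v (Θ x) = Valued.v x) (hΘj : ∀ x, Θ (jE x) = jE (σ x))
    (hjv : ∀ c, Valued.v (jE c) ≤ 1 ↔ Valued.v c ≤ 1) (hjfix : ∀ z, ρ z = z ↔ ∃ c, jE c = z)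
    (hjpow : ∀ (t : E) (n : ℤ), Valued.v (jE t) = Valued.v (jE ϖ) ^ n ↔ Valued.v t = Valued.v ϖ ^ n)
    (hϖmax : ∀ t : M, ρ t = t → Valued.v t < 1 → Valued.v t ≤ Valued.v (jE ϖ))
    (φ : (Fin 2 → E) →+ M) (hφs : ∀ (c : E) (x : Fin 2 → E), φ (c • x) = jE c * φ x) (hφi : Function.Injective φ) (hφo : Function.Surjective φ)
    {γ₂ : GL (Fin 2) E} {lam h : M} (hφγ : ∀ x, φ ((γ₂ : Matrix (Fin 2) (Fin 2) E).mulVec x) = lam * φ x) (hlam : Valued.v lam = 1)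
    (hΘh : Θ h = h) (hh : h ≠ 0) (hform : ∀ x y, jE (pairing σ H₂ x y) = h * Θ (φ x) * φ y + ρ (h * Θ (φ x) * φ y))
    (u : E) {b : ℕ} (hb : 1 ≤ b) (hdb : d ≤ b) {j : ℕ} (hlamj : IsOrd ρ α (jE ϖ ^ j) lam)
    (f : ℕ → ℕ → AddSubgroup M → ℕ)
    (hf : ∀ (b j : ℕ) (Λ : AddSubgroup M) (x₀ : M) (r : E), 1 ≤ b → x₀ ≠ 0 →
      (∀ x, x ∈ Λ ↔ ∃ z, IsOrd ρ α (jE ϖ ^ j) z ∧ x = x₀ * z) →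
      IsOrd ρ α (jE ϖ ^ j) (dualGen ρ Θ α (jE ϖ ^ j) h x₀) → ¬ IsOrd ρ α (jE ϖ ^ j) (dualGen ρ Θ α (jE ϖ ^ j) h x₀ / jE ϖ) →
      Valued.v (dualGen ρ Θ α (jE ϖ ^ j) h x₀) = Valued.v (jE ϖ) ^ b →
      (∀ b', (∀ x ∈ Λ, Valued.v (h * Θ x * b' + ρ (h * Θ x * b')) ≤ 1) → (lam - jE u) * b' ∈ Λ) →
      IsOrd ρ α (jE ϖ ^ j) lam → jE r = glueUnit ρ Θ α (jE ϖ ^ j) h (jE ϖ) (jE hW) x₀ b →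
      f b j Λ = Nat.card {x : 𝒪[E] ⧸ 𝓂[E] ^ (2 * b) // ∃ u' : 𝒪[E], Ideal.Quotient.mk (𝓂[E] ^ (2 * b)) u' = x ∧
        Valued.v ((u' : E) * σ u' - r) ≤ Valued.v (ϖ ^ (2 * b))})
    -- the cell letters
    (hjiso : ∀ a, Valued.v (jE a) = Valued.v a)
    (hcell : levelSetDep ρ Θ α (jE ϖ) h j b (lam - jE u) = levelSet ρ Θ α (jE ϖ) h j b) (hfin : (levelSet ρ Θ α (jE ϖ) h j b).Finite)
    -- the fibration letters, in the consumer's currency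
    (CLS : M → Prop) (Vf : M → M) (ε : Prop) (r : ℤᵐ⁰)
    (Rd : Finset E) (hRd2 : ∀ V : E, σ V = V → Valued.v V ≤ 1 → ∃ V₀ ∈ Rd, Valued.v (V - V₀) ≤ r)
    (hRd3 : ∀ V ∈ Rd, ∀ V' ∈ Rd, Valued.v (V - V') ≤ r → V = V')
    (LIT : E → Prop) [DecidablePred LIT]
    (hI : ∀ (Λ : AddSubgroup M) (x₀ x₀' : M), (x₀ ≠ 0 ∧ (∀ x, x ∈ Λ ↔ ∃ ζ, IsOrd ρ α (jE ϖ ^ j) ζ ∧ x = x₀ * ζ) ∧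
        IsOrd ρ α (jE ϖ ^ j) (dualGen ρ Θ α (jE ϖ ^ j) h x₀) ∧ ¬ IsOrd ρ α (jE ϖ ^ j) (dualGen ρ Θ α (jE ϖ ^ j) h x₀ / jE ϖ) ∧
        Valued.v (dualGen ρ Θ α (jE ϖ ^ j) h x₀) = Valued.v (jE ϖ) ^ b) → (x₀' ≠ 0 ∧ (∀ x, x ∈ Λ ↔ ∃ ζ, IsOrd ρ α (jE ϖ ^ j) ζ ∧ x = x₀' * ζ) ∧
        IsOrd ρ α (jE ϖ ^ j) (dualGen ρ Θ α (jE ϖ ^ j) h x₀') ∧ ¬ IsOrd ρ α (jE ϖ ^ j) (dualGen ρ Θ α (jE ϖ ^ j) h x₀' / jE ϖ) ∧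
        Valued.v (dualGen ρ Θ α (jE ϖ ^ j) h x₀') = Valued.v (jE ϖ) ^ b) → (CLS x₀ ↔ CLS x₀') ∧ Valued.v (Vf x₀' - Vf x₀) ≤ r)
    (hV : ∀ (Λ : AddSubgroup M) (x₀ : M), (x₀ ≠ 0 ∧ (∀ x, x ∈ Λ ↔ ∃ ζ, IsOrd ρ α (jE ϖ ^ j) ζ ∧ x = x₀ * ζ) ∧
        IsOrd ρ α (jE ϖ ^ j) (dualGen ρ Θ α (jE ϖ ^ j) h x₀) ∧ ¬ IsOrd ρ α (jE ϖ ^ j) (dualGen ρ Θ α (jE ϖ ^ j) h x₀ / jE ϖ) ∧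
        Valued.v (dualGen ρ Θ α (jE ϖ ^ j) h x₀) = Valued.v (jE ϖ) ^ b) → ∃ Ve : E, jE Ve = Vf x₀ ∧ σ Ve = Ve ∧ Valued.v Ve ≤ 1)
    (hLit : ∀ (Λ : AddSubgroup M) (x₀ : M) (V₀ : E), (x₀ ≠ 0 ∧ (∀ x, x ∈ Λ ↔ ∃ ζ, IsOrd ρ α (jE ϖ ^ j) ζ ∧ x = x₀ * ζ) ∧
        IsOrd ρ α (jE ϖ ^ j) (dualGen ρ Θ α (jE ϖ ^ j) h x₀) ∧ ¬ IsOrd ρ α (jE ϖ ^ j) (dualGen ρ Θ α (jE ϖ ^ j) h x₀ / jE ϖ) ∧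
        Valued.v (dualGen ρ Θ α (jE ϖ ^ j) h x₀) = Valued.v (jE ϖ) ^ b) → V₀ ∈ Rd → Valued.v (Vf x₀ - jE V₀) ≤ r → LIT V₀)
    -- (hP) populatedness and the per-digit fibre letter ‹K6-(f′)›
    (hP : ∀ (Λ : AddSubgroup M) (x₀ : M), (x₀ ≠ 0 ∧ (∀ x, x ∈ Λ ↔ ∃ ζ, IsOrd ρ α (jE ϖ ^ j) ζ ∧ x = x₀ * ζ) ∧
        IsOrd ρ α (jE ϖ ^ j) (dualGen ρ Θ α (jE ϖ ^ j) h x₀) ∧ ¬ IsOrd ρ α (jE ϖ ^ j) (dualGen ρ Θ α (jE ϖ ^ j) h x₀ / jE ϖ) ∧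
        Valued.v (dualGen ρ Θ α (jE ϖ ^ j) h x₀) = Valued.v (jE ϖ) ^ b) → (f b j Λ ≠ 0 ↔ (CLS x₀ ↔ ε)))
    (φ' : ℕ) (hφ' : ∀ y ∈ Rd.filter LIT,
      {Λ : AddSubgroup M | ∃ x₀, (x₀ ≠ 0 ∧ (∀ x, x ∈ Λ ↔ ∃ ζ, IsOrd ρ α (jE ϖ ^ j) ζ ∧ x = x₀ * ζ) ∧
        IsOrd ρ α (jE ϖ ^ j) (dualGen ρ Θ α (jE ϖ ^ j) h x₀) ∧ ¬ IsOrd ρ α (jE ϖ ^ j) (dualGen ρ Θ α (jE ϖ ^ j) h x₀ / jE ϖ) ∧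
        Valued.v (dualGen ρ Θ α (jE ϖ ^ j) h x₀) = Valued.v (jE ϖ) ^ b) ∧ (CLS x₀ ↔ ε) ∧ Valued.v (Vf x₀ - jE y) ≤ r}.ncard = φ') :
    ((∑ᶠ Λ ∈ levelSetDep ρ Θ α (jE ϖ) h j b (lam - jE u), f b j Λ : ℕ) : ℤ) = (2 * (Nat.card 𝓀[E] : ℤ) ^ b * φ') * ((Rd.filter LIT).card : ℤ) := by
  -- the weighted count is `2q^b ·` the populated count (★ `…FaceTubeAbove`)
  have hw := finsum_levelSetDep_inter_weight_eq_two_mul_pow_mul_ncard_of_le σ hσ hvσ hϖ hD h2v hH₂σ hhW hhWσ jE hρρ hvρ hα hα1 hint hΘΘ hΘρ hvΘ hΘj hjv hjfix hjpow hϖmax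
    φ hφs hφi hφo hφγ hlam hΘh hh hform u hb hdb hlamj f hf
  have hall : ∑ᶠ Λ ∈ levelSetDep ρ Θ α (jE ϖ) h j b (lam - jE u), f b j Λ = ∑ᶠ Λ ∈ levelSetDep ρ Θ α (jE ϖ) h j b (lam - jE u) ∩ {Λ | True}, f b j Λ := by
    rw [show ({Λ | True} : Set (AddSubgroup M)) = Set.univ from Set.setOf_true, Set.inter_univ]
  rw [hall, hw (fun _ => True)]
  -- the populated part is §1's class `S`
  have hpopS : {Λ ∈ levelSetDep ρ Θ α (jE ϖ) h j b (lam - jE u) | True ∧ f b j Λ ≠ 0} =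
      {Λ : AddSubgroup M | ∃ x₀ : M, (x₀ ≠ 0 ∧ (∀ x, x ∈ Λ ↔ ∃ ζ, IsOrd ρ α (jE ϖ ^ j) ζ ∧ x = x₀ * ζ) ∧
        IsOrd ρ α (jE ϖ ^ j) (dualGen ρ Θ α (jE ϖ ^ j) h x₀) ∧ ¬ IsOrd ρ α (jE ϖ ^ j) (dualGen ρ Θ α (jE ϖ ^ j) h x₀ / jE ϖ) ∧
        Valued.v (dualGen ρ Θ α (jE ϖ ^ j) h x₀) = Valued.v (jE ϖ) ^ b) ∧ (CLS x₀ ↔ ε)} := by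
    rw [hcell]
    ext Λ
    rw [Set.mem_sep_iff, mem_levelSet_iff, Set.mem_setOf_eq, true_and]
    constructor
    · rintro ⟨⟨x₀, hG⟩, hw0⟩
      exact ⟨x₀, hG, (hP Λ x₀ hG).1 hw0⟩
    · rintro ⟨x₀, hG, hC⟩
      exact ⟨⟨x₀, hG⟩, (hP Λ x₀ hG).2 hC⟩
  rw [hpopS]
  have key := ncard_eq_mul_card_of_digit_fibre (σ := σ) (X := AddSubgroup M)
    (fun (Λ : AddSubgroup M) (x₀ : M) => (x₀ ≠ 0 ∧ (∀ x, x ∈ Λ ↔ ∃ ζ, IsOrd ρ α (jE ϖ ^ j) ζ ∧ x = x₀ * ζ) ∧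
        IsOrd ρ α (jE ϖ ^ j) (dualGen ρ Θ α (jE ϖ ^ j) h x₀) ∧ ¬ IsOrd ρ α (jE ϖ ^ j) (dualGen ρ Θ α (jE ϖ ^ j) h x₀ / jE ϖ) ∧
        Valued.v (dualGen ρ Θ α (jE ϖ ^ j) h x₀) = Valued.v (jE ϖ) ^ b))
    CLS Vf ε jE hjiso r Rd hRd2 hRd3 LIT hI hV hLit φ' hφ' hfin
  rw [key]
  push_cast
  ring

end Summit.HodgeConjecture.HodgeConjecture.Cruxes.H413.F0P3cDyRamUniformDensityOfUniformFibre

end
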